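import Literature.AlgebraicGeometry.Motives.CartierDivisorIntersectionSubvariety
import Literature.AlgebraicGeometry.Motives.CartierDivisorProjectionFormula
import Literature.AlgebraicGeometry.Motives.CyclesRatTrivialOnPushforward
import Literature.AlgebraicGeometry.Motives.CyclesBirationalLiftProofs
import Literature.AlgebraicGeometry.Motives.ResidueDegreeClosure
import Mathlib.AlgebraicGeometry.IdealSheaf.Functorial
import HarnessLib

/-!
# The projection formula for intersections with a Cartier divisor, at the level of cycles

Fulton, *Intersection Theory*, Prop. 2.3 (c) (projection formula): for a proper morphism
`f : X' → X`, a (pseudo-)divisor `D` on `X` and a `k`-cycle `α` on `X'`,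
`g_*(f^*D · α) = D · f_*(α)` in `A_{k-1}(|D| ∩ f(|α|))`. Printed proof (p. 34): "by functoriality of
pull-back and push-forward we may assume `α = [V]`, `V = X'` and `f(V) = X`; … the content of (c) is
the identity of cycles on `X`: `f_*[f^*D] = deg(X'/X)[D]`", which is
`CartierDivisor.map_cycle_pullback_eq_smul` / `map_cycle_pullback_eq_zero` of
`Motives/CartierDivisorProjectionFormula` (the case `dim X' = dim X`, resp. `dim X' = dim X + 1`).

This file carries out the reduction, for a proper dominant morphism `π : X' → X` of integral
schemes locally of finite type over a field and a Cartier divisor `D` on `X`, with Fulton's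
`D · α` rendered by the cycles `CartierDivisor.primeInter` / `CartierDivisor.interCycle` of
`Motives/CartierDivisorIntersectionCycle` and "equality in `A_{k-1}(Z)`" rendered by membership of
the difference in `ratTrivialOn X Z (k-1)` (`Motives/CyclesRatTrivialOn`):

* `CartierDivisor.map_primeInter_pullback_sub_smul_mem` — for a point `z'` of `X'` with
  `dim closure {z'} = d + 1` and `w = π z'`,
  `π_*((π^*D) · [closure {z'}]) - [κ(z') : κ(w)]_{dim} • (D · [closure {w}]) ∈ Rat_d(X; closure {w} ∩ |D|)`,
  where `[κ(z') : κ(w)]_{dim}` is Mathlib's push-forward weight `AlgebraicCycle.mapCoeff` (the residue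
  degree if `dim closure {w} = d + 1`, else `0`), so that the second term is `D · π_*[closure {z'}]`;
* `CartierDivisor.map_interCycle_pullback_sub_mem` — for a finite `(d+1)`-cycle `β` on `X'`,
  `π_*((π^*D) · β) - D · (π_* β) ∈ Rat_d(X; π(|β|) ∩ |D|)`;
* `CartierDivisor.map_primeInter_pullbackRep_sub_smul_mem`, `CartierDivisor.map_interCycle_pullbackRep_sub_mem`
  — the same along an arbitrary proper `π` (e.g. a closed immersion), with `π^*D` the representative
  `CartierDivisor.pullbackRep D π` of the pulled-back class.

Proof (Fulton's reduction made explicit). Let `V' = closure {z'} ⊆ X'` and `W = closure {w} ⊆ X`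
with their reduced structures (`ClosedSubvariety.ofPoint`), `h : V' → W` the induced proper dominant
(indeed surjective) morphism (`IsClosedImmersion.lift`; a morphism from a reduced scheme factors
through a closed subscheme containing its image). The representative `R_V'` of `(π^*D)|_V'` used by
`primeInter` is linearly equivalent on `V'` to `h^*R_W`, `R_W` the representative of `D|_W`
(functoriality of pull-back of divisor classes, `Motives/CartierDivisorClassPullback`), and is even
the *same* divisor when `W ⊄ |D|` (honest pull-backs); `h_*[h^*R_W] = [R(V'):R(W)] [R_W]` if
`dim W = dim V'` (`map_cycle_pullback_eq_smul`, and `[R(V'):R(W)] = [κ(z'):κ(w)]`,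
`Motives/ResidueDegreeClosure`), `= 0` if `dim W = dim V' - 1` (`map_cycle_pullback_eq_zero`), and
`h_*` kills `d`-cycles if `dim W < d`; the linear-equivalence error is a rationally trivial cycle on
`V'`, pushed into `W ⊆ |D|` (Fulton Thm. 1.4 with supports, `Motives/CyclesRatTrivialOnPushforward`).

## References

* W. Fulton, *Intersection Theory*, 2nd ed., Springer 1998, Prop. 2.3 (c) and its proof (p. 34),
  §1.4. [Fulton1998]
-/

noncomputable section

universe u

open CategoryTheory AlgebraicGeometry Order Topology TopologicalSpace

namespace Literature.AlgebraicGeometry.Motives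

/-! ### Push-forward kills the points whose dimension drops -/

section MapZero

variable {X Y : Scheme.{u}}

/-- If every point of the support of `c` changes dimension under `f`, then `f_* c = 0` (all the
push-forward weights vanish). [folklore] -/
theorem algebraicCycleMap_eq_zero_of_height_ne (f : X ⟶ Y) [QuasiCompact f] (c : AlgebraicCycle X ℤ)
    (h : ∀ x, c x ≠ 0 → height x ≠ height (f.base x)) :
    AlgebraicCycle.map f height height c = 0 := by
  classical
  ext y
  simp only [AlgebraicCycle.map, Function.locallyFinsupp.map_apply,
    Function.locallyFinsuppWithin.coe_zero, Pi.zero_apply]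
  refine finsum_mem_eq_zero_of_forall_eq_zero fun x _ => ?_
  by_cases hx : c x = 0
  · rw [hx, zero_mul]
  · simp [AlgebraicCycle.mapCoeff, h x hx]

end MapZero

/-! ### Lifting `closure {z'} → closure {π z'}` -/

namespace ClosedSubvariety

variable {X' X : Scheme.{u}}

/-- **`π` restricts to a surjection `closure {z'} → closure {π z'}` of the reduced closures** for a
closed morphism `π`: the morphism `closure {z'} ↪ X' → X` from a reduced scheme has image inside the
closed set `closure {π z'}`, hence factors through its reduced induced structure
(Mathlib `IsClosedImmersion.lift`; the kernel of a morphism with reduced source is the vanishing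
ideal of the closure of its image), and `π(closure {z'}) = closure {π z'}` as `π` is closed. [folklore] -/
theorem exists_hom_ofPoint_fac (π : X' ⟶ X) (hπ : IsClosedMap π.base) (z' : X') :
    ∃ h : (ofPoint X' z').carrier ⟶ (ofPoint X (π.base z')).carrier,
      h ≫ (ofPoint X (π.base z')).ι = (ofPoint X' z').ι ≫ π ∧ Function.Surjective h.base := by
  set V' := ofPoint X' z' with hVdef
  set O := ofPoint X (π.base z') with hO
  have hrange : Set.range ((V'.ι ≫ π).base) = closure {π.base z'} := by
    rw [Scheme.Hom.comp_base, TopCat.coe_comp, Set.range_comp, range_ofPoint_ι]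
    apply subset_antisymm
    · simpa using image_closure_subset_closure_image (s := {z'}) π.base.hom.continuous
    · exact closure_minimal (Set.singleton_subset_iff.2 ⟨z', subset_closure rfl, rfl⟩)
        (hπ _ isClosed_closure)
  -- kernels of morphisms from reduced schemes are vanishing ideals of the closures of the images
  have hker_eq : ∀ {V : Scheme.{u}} [IsReduced V] (f : V ⟶ X),
      f.ker = Scheme.IdealSheafData.vanishingIdeal (Closeds.closure (Set.range f.base)) := by
    intro V _ f
    rw [← Scheme.IdealSheafData.map_bot, ← Scheme.nilradical_eq_bot,
      ← Scheme.IdealSheafData.vanishingIdeal_top, Scheme.IdealSheafData.map_vanishingIdeal,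
      Closeds.coe_top, Set.image_univ]
  have hker : O.ι.ker ≤ (V'.ι ≫ π).ker := by
    rw [hker_eq, hker_eq]
    refine Scheme.IdealSheafData.vanishingIdeal_antimono (Closeds.closure_le.2 ?_)
    change Set.range (V'.ι ≫ π).base ⊆ closure (Set.range O.ι.base)
    rw [hrange, range_ofPoint_ι, closure_closure]
  refine ⟨IsClosedImmersion.lift O.ι (V'.ι ≫ π) hker, IsClosedImmersion.lift_fac _ _ _, fun y => ?_⟩
  have hy : O.ι.base y ∈ Set.range ((V'.ι ≫ π).base) := by
    rw [hrange, ← range_ofPoint_ι]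
    exact ⟨y, rfl⟩
  obtain ⟨v, hv⟩ := hy
  refine ⟨v, O.ι.isClosedEmbedding.injective ?_⟩
  rw [← Scheme.Hom.comp_apply, IsClosedImmersion.lift_fac]
  exact hv

end ClosedSubvariety

namespace CartierDivisor

open RatFn

/-! ### Divisors: pull-back lemmas -/

section Divisors

variable {X Y Z : Scheme.{u}} [IsIntegral X] [IsIntegral Y] [IsIntegral Z]

/-- `pullbackAvoiding` along equal morphisms gives the same divisor. [folklore] -/
theorem pullbackAvoiding_congr_sameDivisor (D : CartierDivisor X) {g₁ g₂ : Y ⟶ X} (e : g₁ = g₂)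
    (h₁ : D.Avoids (g₁ (genericPoint Y))) (h₂ : D.Avoids (g₂ (genericPoint Y))) :
    (D.pullbackAvoiding g₁ h₁).SameDivisor (D.pullbackAvoiding g₂ h₂) := by
  subst e
  exact SameDivisor.refl _

/-- If `D` avoids `g x'` then `g^*D` avoids `x'` (for a dominant `g`). [folklore] -/
theorem Avoids.pullback {D : CartierDivisor X} (g : Y ⟶ X) [IsDominant g] {x' : Y}
    (h : D.Avoids (g x')) : (D.pullback g).Avoids x' :=
  fun i hi => (h i hi).functionFieldMap

/-- **`(g ≫ f)^*D` versus `g^*(f^*D)` for `f` dominant and `D` avoiding `f(g(η_Z))`**: the honest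
pull-back of `f^*D` along `g` is the honest pull-back of `D` along `g ≫ f` (same divisor). [folklore] -/
theorem pullbackAvoiding_pullback_sameDivisor (D : CartierDivisor X) (f : Y ⟶ X) [IsDominant f]
    (g : Z ⟶ Y) (h : D.Avoids (f (g (genericPoint Z)))) :
    ((D.pullback f).pullbackAvoiding g (h.pullback f)).SameDivisor
      (D.pullbackAvoiding (g ≫ f) h) := by
  have hf : D.Avoids (f (genericPoint Y)) := D.avoids_apply_genericPoint f
  exact ((pullbackAvoiding_sameDivisor_pullback f D hf).symm.pullbackAvoiding g
    (h.pullback f) (h.pullbackAvoiding f g hf)).trans (pullbackAvoiding_comp_sameDivisor f g h hf).symm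

end Divisors

/-! ### The projection formula for a prime cycle -/

section Prime

variable {K : Type u} [Field K] {X' X : SchemeOver K} [IsIntegral X'.left] [IsIntegral X.left]
  [LocallyOfFiniteType X'.hom] [LocallyOfFiniteType X.hom]

/-- **Fulton, Prop. 2.3 (c) for a prime cycle, at the level of cycles.** For a proper dominant
`π : X' → X`, a Cartier divisor `D` on `X`, and a point `z'` of `X'` with `dim closure {z'} = d + 1`
and image `w = π z'`:
`π_*((π^*D) · [closure {z'}]) - m • (D · [closure {w}]) ∈ Rat_d(X; closure {w} ∩ |D|)`, where
`m = AlgebraicCycle.mapCoeff π z'` is the push-forward weight (`[κ(z'):κ(w)]` if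
`dim closure {w} = d + 1`, else `0`), i.e. `m • (D · [closure {w}]) = D · π_*[closure {z'}]`; and the
two cycles are *equal* when `closure {w} ⊄ |D|`. [cite: Fulton1998, Prop. 2.3 (c) (p. 34)] -/
theorem map_primeInter_pullback_sub_smul_mem (π : X' ⟶ X) [IsProper π.left] [IsDominant π.left]
    (D : CartierDivisor X.left) {z' : X'.left} {d : ℕ} (hz' : height z' = d + 1) :
    AlgebraicCycle.map π.left height height ((D.pullback π.left).primeInter z') -
        (AlgebraicCycle.mapCoeff π.left height height z' : ℤ) • D.primeInter (π.left.base z') ∈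
      ratTrivialOn X.left (closure {π.left.base z'} ∩ {x | ¬ D.Avoids x}) d := by
  classical
  set w := π.left.base z' with hw
  set V' := ClosedSubvariety.ofPoint X'.left z' with hVdef
  set O := ClosedSubvariety.ofPoint X.left w with hO
  -- the induced `h : V' → O`, surjective, proper, dominant, over `K`
  obtain ⟨h, fac, hsurj⟩ := ClosedSubvariety.exists_hom_ofPoint_fac π.left π.left.isClosedMap z'
  haveI : IsDominant h := ⟨hsurj.denseRange⟩
  haveI : IsProper (h ≫ O.ι) := by rw [fac]; infer_instance
  haveI : IsProper h := IsProper.of_comp h O.ι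
  let hK : V'.over X'.hom ⟶ O.over X.hom := Over.homMk h (by
    change h ≫ O.ι ≫ X.hom = V'.ι ≫ X'.hom
    rw [← Category.assoc, fac, Category.assoc, Over.w π])
  haveI : IsProper hK.left := inferInstanceAs (IsProper h)
  haveI : IsDominant hK.left := inferInstanceAs (IsDominant h)
  -- dimensions
  have hVd : height (⊤ : ↥(V'.over X'.hom).left) = d + 1 := by
    rw [← hz']; exact height_top_ofPoint z'
  have hOd : height (⊤ : ↥(O.over X.hom).left) = height w := height_top_ofPoint w
  have hwle : height w ≤ d + 1 := by
    rw [← hz']; exact height_base_le_of_isClosedMap π.left π.left.isClosedMap z'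
  -- generic points
  have hgenV : V'.ι (genericPoint V'.carrier) = z' := ClosedSubvariety.genericPoint_ofPoint z'
  have hgenO : O.ι (genericPoint O.carrier) = w := ClosedSubvariety.genericPoint_ofPoint w
  have hgenh : V'.ι (genericPoint V'.carrier) = z' := hgenV
  have hπgen : π.left (V'.ι (genericPoint V'.carrier)) = w := by rw [hgenV]
  have hOh : O.ι (h (genericPoint V'.carrier)) = w := by
    rw [← Scheme.Hom.comp_apply, fac, Scheme.Hom.comp_apply, hgenV]
  -- the representatives
  set RV := (D.pullback π.left).pullbackRep V'.ι with hRV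
  set RO := D.pullbackRep O.ι with hRO
  -- (i) `R_V' ∼ h^* R_O` always
  have hlin : RV.LinEquiv (RO.pullback h) := by
    have e1 : RV.LinEquiv ((D.pullback π.left).classPullback V'.ι) :=
      ((D.pullback π.left).classPullback_linEquiv_pullbackRep V'.ι).symm
    have e2 : ((D.pullback π.left).classPullback V'.ι).LinEquiv ((D.classPullback π.left).classPullback V'.ι) :=
      (D.classPullback_linEquiv_pullback π.left).symm.classPullback V'.ι
    have e3 : ((D.classPullback π.left).classPullback V'.ι).LinEquiv (D.classPullback (V'.ι ≫ π.left)) :=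
      (D.classPullback_comp_linEquiv π.left V'.ι).symm
    have e4 : D.classPullback (V'.ι ≫ π.left) = D.classPullback (h ≫ O.ι) := classPullback_congr fac.symm D
    have e5 : (D.classPullback (h ≫ O.ι)).LinEquiv ((D.classPullback O.ι).classPullback h) :=
      D.classPullback_comp_linEquiv O.ι h
    have e6 : ((D.classPullback O.ι).classPullback h).LinEquiv (RO.classPullback h) :=
      (D.classPullback_linEquiv_pullbackRep O.ι).classPullback h
    have e7 : (RO.classPullback h).LinEquiv (RO.pullback h) := RO.classPullback_linEquiv_pullback h
    rw [e4] at e3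
    exact ((((e1.trans e2).trans e3).trans e5).trans e6).trans e7
  -- (ii) `R_V' = h^* R_O` (same divisor) when `D` avoids `w`
  have hsame : D.Avoids w → RV.SameDivisor (RO.pullback h) := fun hDw => by
    have hO' : D.Avoids (O.ι (genericPoint O.carrier)) := by rwa [hgenO]
    have hVav : (D.pullback π.left).Avoids (V'.ι (genericPoint V'.carrier)) :=
      Avoids.pullback π.left (by rwa [hπgen])
    have hcomp : D.Avoids ((V'.ι ≫ π.left) (genericPoint V'.carrier)) := by
      rwa [Scheme.Hom.comp_apply, hπgen]
    have hcomp' : D.Avoids ((h ≫ O.ι) (genericPoint V'.carrier)) := by rwa [fac]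
    have hOh' : D.Avoids (O.ι (h (genericPoint V'.carrier))) := by rwa [hOh]
    rw [hRV, hRO, pullbackRep_of_avoids _ _ hVav, pullbackRep_of_avoids _ _ hO']
    -- `(π^*D)|_V' = D|_{V' → X} = (D|_O)^{h}`
    refine ((D.pullbackAvoiding_pullback_sameDivisor π.left V'.ι hcomp).trans
      ((D.pullbackAvoiding_congr_sameDivisor fac.symm hcomp hcomp').trans ?_))
    exact (pullbackAvoiding_comp_sameDivisor O.ι h hOh' hO').trans
      (pullbackAvoiding_sameDivisor_pullback h _ _)
  -- (iii) `h_*[h^* R_O] = m • [R_O]` with `m` the push-forward weight of `π` at `z'`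
  have hA4 : AlgebraicCycle.map h height height (RO.pullback h).cycle =
      (AlgebraicCycle.mapCoeff π.left height height z' : ℤ) • RO.cycle := by
    by_cases hdim : height w = d + 1
    · -- equal dimensions: `deg(V'/O) = [κ(z') : κ(w)]`
      have heq : height z' = height (π.left.base z') := by
        change height z' = height w
        rw [hz', hdim]
      have hcoeff : (AlgebraicCycle.mapCoeff π.left height height z' : ℤ) = π.left.residueDegree z' := by
        rw [show AlgebraicCycle.mapCoeff π.left height height z' = π.left.residueDegree z' from if_pos heq]
      have hdeg : π.left.residueDegree z' =
          (letI := (functionFieldMap h).toAlgebra;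
            Module.finrank O.carrier.functionField V'.carrier.functionField) := by
        have e := V'.residueDegree_eq_finrank_of_fac π.left O h fac
        rw [hgenV] at e
        exact e
      have hVd' : height (⊤ : ↥(V'.over X'.hom).left) = ((d + 1 : ℕ) : ℕ∞) := by
        rw [hVd, Nat.cast_succ]
      have hOd' : height (⊤ : ↥(O.over X.hom).left) = ((d + 1 : ℕ) : ℕ∞) := by
        rw [hOd, hdim, Nat.cast_succ]
      rw [hcoeff, hdeg]
      exact map_cycle_pullback_eq_smul hK hVd' hOd' RO
    · have hne : height z' ≠ height (π.left.base z') := by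
        change height z' ≠ height w
        rw [hz']
        exact fun e => hdim e.symm
      have hcoeff : (AlgebraicCycle.mapCoeff π.left height height z' : ℤ) = 0 := by
        rw [show AlgebraicCycle.mapCoeff π.left height height z' = 0 from if_neg hne, Nat.cast_zero]
      rw [hcoeff, zero_smul]
      by_cases hdim' : height w = d
      · exact map_cycle_pullback_eq_zero hK hVd (hOd.trans hdim') RO
      · -- `dim O < d`: every `d`-dimensional point of `V'` drops dimension
        have hlt : height w < d := by
          have h1 : height w < d + 1 := lt_of_le_of_ne hwle hdim
          have h2 : height w ≤ d := Order.le_of_lt_add_one h1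
          exact lt_of_le_of_ne h2 hdim'
        have hmem : (RO.pullback h).cycle ∈ cyclesOfDim V'.carrier d :=
          cycle_mem_cyclesOfDim (V := V'.over X'.hom) hVd _
        refine algebraicCycleMap_eq_zero_of_height_ne h _ fun x hx => ?_
        have hxd : height x = d := by
          have := hmem x hx
          exact_mod_cast this
        rw [hxd]
        refine ne_of_gt (lt_of_le_of_lt ?_ hlt)
        have hs : w ⤳ O.ι.base (h.base x) := ClosedSubvariety.specializes_ofPoint_ι w _
        calc height (h.base x) = height (O.ι.base (h.base x)) :=
              (height_base_eq_of_isClosedImmersion' O.ι _).symm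
          _ ≤ height w := height_mono (Scheme.le_iff_specializes.mpr hs)
  -- (iv) assembly
  have hLHS : AlgebraicCycle.map π.left height height ((D.pullback π.left).primeInter z') =
      AlgebraicCycle.map O.ι height height (AlgebraicCycle.map h height height RV.cycle) := by
    change AlgebraicCycle.map π.left height height (AlgebraicCycle.map V'.ι height height RV.cycle) = _
    rw [← algebraicCycleMap_comp V'.ι π.left V'.ι.isClosedMap π.left.isClosedMap,
      algebraicCycleMap_congr fac.symm, algebraicCycleMap_comp h O.ι h.isClosedMap O.ι.isClosedMap]
  have hRHS : (AlgebraicCycle.mapCoeff π.left height height z' : ℤ) • D.primeInter w =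
      AlgebraicCycle.map O.ι height height (AlgebraicCycle.map h height height (RO.pullback h).cycle) := by
    have hz : ∀ (m : ℤ) (c : AlgebraicCycle O.carrier ℤ), AlgebraicCycle.map O.ι height height (m • c) =
        m • AlgebraicCycle.map O.ι height height c := fun m c =>
      map_zsmul (AddMonoidHom.mk' (AlgebraicCycle.map O.ι height height)
        (algebraicCycleMap_add O.ι height height)) m c
    rw [hA4, hz]
    rfl
  rw [hLHS, hRHS, ← algebraicCycleMap_sub', ← algebraicCycleMap_sub']
  by_cases hDw : D.Avoids w
  · rw [(hsame hDw).cycle_eq, sub_self, algebraicCycleMap_zero, algebraicCycleMap_zero]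
    exact zero_mem _
  · -- the error is a rationally trivial cycle on `V'`, pushed into `O = closure {w} ⊆ |D|`
    have hsub : closure {w} ⊆ closure {w} ∩ {x | ¬ D.Avoids x} := fun x hx =>
      ⟨hx, fun hDx => hDw (hDx.of_specializes (specializes_iff_mem_closure.mpr hx))⟩
    refine ratTrivialOn_mono hsub ?_
    have h1 : RV.cycle - (RO.pullback h).cycle ∈ ratTrivialOn (V'.over X'.hom).left Set.univ d := by
      rw [ratTrivialOn_univ]
      exact hlin.symm.cycle_sub_cycle_mem_ratTrivial (V := V'.over X'.hom) hVd
    have h2 := map_mem_ratTrivialOn_image hK h1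
    have h3 := map_mem_ratTrivialOn_of_mem_ratTrivialOn O.ι h2
    rw [← ClosedSubvariety.range_ofPoint_ι w]
    refine ratTrivialOn_mono ?_ h3
    rintro _ ⟨y, -, rfl⟩
    exact ⟨y, rfl⟩

end Prime

/-! ### The projection formula for a finite cycle -/

section Cycle

variable {K : Type u} [Field K] {X' X : SchemeOver K} [IsIntegral X'.left] [IsIntegral X.left]
  [LocallyOfFiniteType X'.hom] [LocallyOfFiniteType X.hom]

/-- **Fulton, Prop. 2.3 (c) (projection formula) at the level of cycles**: for a proper dominant
`π : X' → X`, a Cartier divisor `D` on `X` and a finite `(d+1)`-cycle `β` on `X'`,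
`π_*((π^*D) · β) - D · (π_* β) ∈ Rat_d(X; π(|β|) ∩ |D|)` ("`g_*(f^*D · α) = D · f_*(α)` in
`A_{k-1}(|D| ∩ f(|α|))`"). By linearity from the prime-cycle case
`map_primeInter_pullback_sub_smul_mem` (`π_*[closure {z'}] = [κ(z'):κ(π z')]_{dim} [closure {π z'}]`,
`algebraicCycleMap_primeCycle_eq_nsmul`). [cite: Fulton1998, Prop. 2.3 (c) (p. 34)] -/
theorem map_interCycle_pullback_sub_mem (π : X' ⟶ X) [IsProper π.left] [IsDominant π.left]
    (D : CartierDivisor X.left) {β : AlgebraicCycle X'.left ℤ} {d : ℕ}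
    (hβd : β ∈ cyclesOfDim X'.left (d + 1)) (hβ : (Function.support β).Finite) :
    AlgebraicCycle.map π.left height height ((D.pullback π.left).interCycle β) -
        D.interCycle (AlgebraicCycle.map π.left height height β) ∈
      ratTrivialOn X.left ({x | ∃ z', β z' ≠ 0 ∧ π.left.base z' ⤳ x} ∩ {x | ¬ D.Avoids x}) d := by
  classical
  -- both sides are additive in `β`
  let mapHom : AlgebraicCycle X'.left ℤ →+ AlgebraicCycle X.left ℤ :=
    AddMonoidHom.mk' (AlgebraicCycle.map π.left height height) (algebraicCycleMap_add π.left height height)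
  let φ : AlgebraicCycle X'.left ℤ →+ AlgebraicCycle X.left ℤ :=
    mapHom.comp (D.pullback π.left).interCycleHom - D.interCycleHom.comp mapHom
  have hφ : ∀ γ, φ γ = AlgebraicCycle.map π.left height height ((D.pullback π.left).interCycle γ) -
      D.interCycle (AlgebraicCycle.map π.left height height γ) := fun γ => rfl
  have hsum : φ β = ∑ z ∈ hβ.toFinset, β z • φ (primeCycle z) := by
    conv_lhs => rw [eq_sum_smul_primeCycle_of_finite β hβ]
    rw [map_sum]
    simp only [map_zsmul]
  rw [← hφ, hsum]
  refine AddSubgroup.sum_mem _ fun z' hz' => ?_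
  have hz'0 : β z' ≠ 0 := hβ.mem_toFinset.mp hz'
  have hzd : height z' = d + 1 := by
    rw [hβd z' hz'0]
    push_cast
    rfl
  refine AddSubgroup.zsmul_mem _ ?_ _
  -- the prime cycle `[closure {z'}]`
  rw [hφ, interCycle_primeCycle, algebraicCycleMap_primeCycle_eq_nsmul, ← natCast_zsmul,
    interCycle_zsmul, interCycle_primeCycle]
  refine ratTrivialOn_mono (Set.inter_subset_inter_left _ fun x hx => ?_)
    (map_primeInter_pullback_sub_smul_mem π D hzd)
  exact ⟨z', hz'0, specializes_iff_mem_closure.mpr hx⟩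

end Cycle


/-! ### The projection formula along an arbitrary proper morphism -/

section PrimeRep

variable {K : Type u} [Field K] {X' X : SchemeOver K} [IsIntegral X'.left] [IsIntegral X.left]
  [LocallyOfFiniteType X'.hom] [LocallyOfFiniteType X.hom]

/-- **Fulton, Prop. 2.3 (c) for a prime cycle, at the level of cycles, for an arbitrary proper
morphism** `π : X' → X` (not necessarily dominant), `π^*D` being the representative
`CartierDivisor.pullbackRep D π` of the pulled-back divisor class (the honest pull-back when
`π(X') ⊄ |D|`): for a Cartier divisor `D` on `X` and a point `z'` of `X'` with
`dim closure {z'} = d + 1`, `w = π z'`,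
`π_*((π^*D) · [closure {z'}]) - m • (D · [closure {w}]) ∈ Rat_d(X; closure {w} ∩ |D|)` with
`m = AlgebraicCycle.mapCoeff π z'`; the two cycles are *equal* when `closure {w} ⊄ |D|`. (E.g. `π` a
closed immersion: "by functoriality of push-forward we may assume … `V = X'`", p. 34.)
[cite: Fulton1998, Prop. 2.3 (c) (p. 34)] -/
theorem map_primeInter_pullbackRep_sub_smul_mem (π : X' ⟶ X) [IsProper π.left]
    (D : CartierDivisor X.left) {z' : X'.left} {d : ℕ} (hz' : height z' = d + 1) :
    AlgebraicCycle.map π.left height height ((D.pullbackRep π.left).primeInter z') -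
        (AlgebraicCycle.mapCoeff π.left height height z' : ℤ) • D.primeInter (π.left.base z') ∈
      ratTrivialOn X.left (closure {π.left.base z'} ∩ {x | ¬ D.Avoids x}) d := by
  classical
  set w := π.left.base z' with hw
  set V' := ClosedSubvariety.ofPoint X'.left z' with hVdef
  set O := ClosedSubvariety.ofPoint X.left w with hO
  -- the induced `h : V' → O`, surjective, proper, dominant, over `K`
  obtain ⟨h, fac, hsurj⟩ := ClosedSubvariety.exists_hom_ofPoint_fac π.left π.left.isClosedMap z'
  haveI : IsDominant h := ⟨hsurj.denseRange⟩
  haveI : IsProper (h ≫ O.ι) := by rw [fac]; infer_instance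
  haveI : IsProper h := IsProper.of_comp h O.ι
  let hK : V'.over X'.hom ⟶ O.over X.hom := Over.homMk h (by
    change h ≫ O.ι ≫ X.hom = V'.ι ≫ X'.hom
    rw [← Category.assoc, fac, Category.assoc, Over.w π])
  haveI : IsProper hK.left := inferInstanceAs (IsProper h)
  haveI : IsDominant hK.left := inferInstanceAs (IsDominant h)
  -- dimensions
  have hVd : height (⊤ : ↥(V'.over X'.hom).left) = d + 1 := by
    rw [← hz']; exact height_top_ofPoint z'
  have hOd : height (⊤ : ↥(O.over X.hom).left) = height w := height_top_ofPoint w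
  have hwle : height w ≤ d + 1 := by
    rw [← hz']; exact height_base_le_of_isClosedMap π.left π.left.isClosedMap z'
  -- generic points
  have hgenV : V'.ι (genericPoint V'.carrier) = z' := ClosedSubvariety.genericPoint_ofPoint z'
  have hgenO : O.ι (genericPoint O.carrier) = w := ClosedSubvariety.genericPoint_ofPoint w
  have hgenh : V'.ι (genericPoint V'.carrier) = z' := hgenV
  have hπgen : π.left (V'.ι (genericPoint V'.carrier)) = w := by rw [hgenV]
  have hOh : O.ι (h (genericPoint V'.carrier)) = w := by
    rw [← Scheme.Hom.comp_apply, fac, Scheme.Hom.comp_apply, hgenV]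
  -- the representatives
  set RV := (D.pullbackRep π.left).pullbackRep V'.ι with hRV
  set RO := D.pullbackRep O.ι with hRO
  -- (i) `R_V' ∼ h^* R_O` always
  have hlin : RV.LinEquiv (RO.pullback h) := by
    have e1 : RV.LinEquiv ((D.pullbackRep π.left).classPullback V'.ι) :=
      ((D.pullbackRep π.left).classPullback_linEquiv_pullbackRep V'.ι).symm
    have e2 : ((D.pullbackRep π.left).classPullback V'.ι).LinEquiv ((D.classPullback π.left).classPullback V'.ι) :=
      (D.classPullback_linEquiv_pullbackRep π.left).symm.classPullback V'.ι
    have e3 : ((D.classPullback π.left).classPullback V'.ι).LinEquiv (D.classPullback (V'.ι ≫ π.left)) :=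
      (D.classPullback_comp_linEquiv π.left V'.ι).symm
    have e4 : D.classPullback (V'.ι ≫ π.left) = D.classPullback (h ≫ O.ι) := classPullback_congr fac.symm D
    have e5 : (D.classPullback (h ≫ O.ι)).LinEquiv ((D.classPullback O.ι).classPullback h) :=
      D.classPullback_comp_linEquiv O.ι h
    have e6 : ((D.classPullback O.ι).classPullback h).LinEquiv (RO.classPullback h) :=
      (D.classPullback_linEquiv_pullbackRep O.ι).classPullback h
    have e7 : (RO.classPullback h).LinEquiv (RO.pullback h) := RO.classPullback_linEquiv_pullback h
    rw [e4] at e3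
    exact ((((e1.trans e2).trans e3).trans e5).trans e6).trans e7
  -- (ii) `R_V' = h^* R_O` (same divisor) when `D` avoids `w`
  have hsame : D.Avoids w → RV.SameDivisor (RO.pullback h) := fun hDw => by
    have hO' : D.Avoids (O.ι (genericPoint O.carrier)) := by rwa [hgenO]
    have hπz' : D.Avoids (π.left z') := hDw
    have hgenX' : D.Avoids (π.left (genericPoint X'.left)) := hπz'.apply_genericPoint
    have hcomp : D.Avoids (π.left (V'.ι (genericPoint V'.carrier))) := by rwa [hπgen]
    have hVav : (D.pullbackAvoiding π.left hgenX').Avoids (V'.ι (genericPoint V'.carrier)) :=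
      hcomp.pullbackAvoiding π.left V'.ι hgenX'
    have hcomp' : D.Avoids ((V'.ι ≫ π.left) (genericPoint V'.carrier)) := by
      rwa [Scheme.Hom.comp_apply, hπgen]
    have hcomp'' : D.Avoids ((h ≫ O.ι) (genericPoint V'.carrier)) := by rwa [fac]
    have hOh' : D.Avoids (O.ι (h (genericPoint V'.carrier))) := by rwa [hOh]
    rw [hRV, hRO, pullbackRep_of_avoids D π.left hgenX', pullbackRep_of_avoids _ _ hVav,
      pullbackRep_of_avoids _ _ hO']
    -- `(π^*D)|_V' = D|_{V' → X} = (D|_O)^{h}`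
    refine ((pullbackAvoiding_comp_sameDivisor π.left V'.ι hcomp hgenX').symm.trans
      ((D.pullbackAvoiding_congr_sameDivisor fac.symm hcomp' hcomp'').trans ?_))
    exact (pullbackAvoiding_comp_sameDivisor O.ι h hOh' hO').trans
      (pullbackAvoiding_sameDivisor_pullback h _ _)
  -- (iii) `h_*[h^* R_O] = m • [R_O]` with `m` the push-forward weight of `π` at `z'`
  have hA4 : AlgebraicCycle.map h height height (RO.pullback h).cycle =
      (AlgebraicCycle.mapCoeff π.left height height z' : ℤ) • RO.cycle := by
    by_cases hdim : height w = d + 1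
    · -- equal dimensions: `deg(V'/O) = [κ(z') : κ(w)]`
      have heq : height z' = height (π.left.base z') := by
        change height z' = height w
        rw [hz', hdim]
      have hcoeff : (AlgebraicCycle.mapCoeff π.left height height z' : ℤ) = π.left.residueDegree z' := by
        rw [show AlgebraicCycle.mapCoeff π.left height height z' = π.left.residueDegree z' from if_pos heq]
      have hdeg : π.left.residueDegree z' =
          (letI := (functionFieldMap h).toAlgebra;
            Module.finrank O.carrier.functionField V'.carrier.functionField) := by
        have e := V'.residueDegree_eq_finrank_of_fac π.left O h fac
        rw [hgenV] at e
        exact e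
      have hVd' : height (⊤ : ↥(V'.over X'.hom).left) = ((d + 1 : ℕ) : ℕ∞) := by
        rw [hVd, Nat.cast_succ]
      have hOd' : height (⊤ : ↥(O.over X.hom).left) = ((d + 1 : ℕ) : ℕ∞) := by
        rw [hOd, hdim, Nat.cast_succ]
      rw [hcoeff, hdeg]
      exact map_cycle_pullback_eq_smul hK hVd' hOd' RO
    · have hne : height z' ≠ height (π.left.base z') := by
        change height z' ≠ height w
        rw [hz']
        exact fun e => hdim e.symm
      have hcoeff : (AlgebraicCycle.mapCoeff π.left height height z' : ℤ) = 0 := by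
        rw [show AlgebraicCycle.mapCoeff π.left height height z' = 0 from if_neg hne, Nat.cast_zero]
      rw [hcoeff, zero_smul]
      by_cases hdim' : height w = d
      · exact map_cycle_pullback_eq_zero hK hVd (hOd.trans hdim') RO
      · -- `dim O < d`: every `d`-dimensional point of `V'` drops dimension
        have hlt : height w < d := by
          have h1 : height w < d + 1 := lt_of_le_of_ne hwle hdim
          have h2 : height w ≤ d := Order.le_of_lt_add_one h1
          exact lt_of_le_of_ne h2 hdim'
        have hmem : (RO.pullback h).cycle ∈ cyclesOfDim V'.carrier d :=
          cycle_mem_cyclesOfDim (V := V'.over X'.hom) hVd _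
        refine algebraicCycleMap_eq_zero_of_height_ne h _ fun x hx => ?_
        have hxd : height x = d := by
          have := hmem x hx
          exact_mod_cast this
        rw [hxd]
        refine ne_of_gt (lt_of_le_of_lt ?_ hlt)
        have hs : w ⤳ O.ι.base (h.base x) := ClosedSubvariety.specializes_ofPoint_ι w _
        calc height (h.base x) = height (O.ι.base (h.base x)) :=
              (height_base_eq_of_isClosedImmersion' O.ι _).symm
          _ ≤ height w := height_mono (Scheme.le_iff_specializes.mpr hs)
  -- (iv) assembly
  have hLHS : AlgebraicCycle.map π.left height height ((D.pullbackRep π.left).primeInter z') =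
      AlgebraicCycle.map O.ι height height (AlgebraicCycle.map h height height RV.cycle) := by
    change AlgebraicCycle.map π.left height height (AlgebraicCycle.map V'.ι height height RV.cycle) = _
    rw [← algebraicCycleMap_comp V'.ι π.left V'.ι.isClosedMap π.left.isClosedMap,
      algebraicCycleMap_congr fac.symm, algebraicCycleMap_comp h O.ι h.isClosedMap O.ι.isClosedMap]
  have hRHS : (AlgebraicCycle.mapCoeff π.left height height z' : ℤ) • D.primeInter w =
      AlgebraicCycle.map O.ι height height (AlgebraicCycle.map h height height (RO.pullback h).cycle) := by
    have hz : ∀ (m : ℤ) (c : AlgebraicCycle O.carrier ℤ), AlgebraicCycle.map O.ι height height (m • c) =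
        m • AlgebraicCycle.map O.ι height height c := fun m c =>
      map_zsmul (AddMonoidHom.mk' (AlgebraicCycle.map O.ι height height)
        (algebraicCycleMap_add O.ι height height)) m c
    rw [hA4, hz]
    rfl
  rw [hLHS, hRHS, ← algebraicCycleMap_sub', ← algebraicCycleMap_sub']
  by_cases hDw : D.Avoids w
  · rw [(hsame hDw).cycle_eq, sub_self, algebraicCycleMap_zero, algebraicCycleMap_zero]
    exact zero_mem _
  · -- the error is a rationally trivial cycle on `V'`, pushed into `O = closure {w} ⊆ |D|`
    have hsub : closure {w} ⊆ closure {w} ∩ {x | ¬ D.Avoids x} := fun x hx =>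
      ⟨hx, fun hDx => hDw (hDx.of_specializes (specializes_iff_mem_closure.mpr hx))⟩
    refine ratTrivialOn_mono hsub ?_
    have h1 : RV.cycle - (RO.pullback h).cycle ∈ ratTrivialOn (V'.over X'.hom).left Set.univ d := by
      rw [ratTrivialOn_univ]
      exact hlin.symm.cycle_sub_cycle_mem_ratTrivial (V := V'.over X'.hom) hVd
    have h2 := map_mem_ratTrivialOn_image hK h1
    have h3 := map_mem_ratTrivialOn_of_mem_ratTrivialOn O.ι h2
    rw [← ClosedSubvariety.range_ofPoint_ι w]
    refine ratTrivialOn_mono ?_ h3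
    rintro _ ⟨y, -, rfl⟩
    exact ⟨y, rfl⟩

end PrimeRep

section CycleRep

variable {K : Type u} [Field K] {X' X : SchemeOver K} [IsIntegral X'.left] [IsIntegral X.left]
  [LocallyOfFiniteType X'.hom] [LocallyOfFiniteType X.hom]

/-- **Fulton, Prop. 2.3 (c) (projection formula) at the level of cycles, along an arbitrary proper
morphism** `π : X' → X`, with `π^*D := CartierDivisor.pullbackRep D π`: for a finite `(d+1)`-cycle `β`
on `X'`, `π_*((π^*D) · β) - D · (π_* β) ∈ Rat_d(X; π(|β|) ∩ |D|)`.
[cite: Fulton1998, Prop. 2.3 (c) (p. 34)] -/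
theorem map_interCycle_pullbackRep_sub_mem (π : X' ⟶ X) [IsProper π.left]
    (D : CartierDivisor X.left) {β : AlgebraicCycle X'.left ℤ} {d : ℕ}
    (hβd : β ∈ cyclesOfDim X'.left (d + 1)) (hβ : (Function.support β).Finite) :
    AlgebraicCycle.map π.left height height ((D.pullbackRep π.left).interCycle β) -
        D.interCycle (AlgebraicCycle.map π.left height height β) ∈
      ratTrivialOn X.left ({x | ∃ z', β z' ≠ 0 ∧ π.left.base z' ⤳ x} ∩ {x | ¬ D.Avoids x}) d := by
  classical
  -- both sides are additive in `β`
  let mapHom : AlgebraicCycle X'.left ℤ →+ AlgebraicCycle X.left ℤ :=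
    AddMonoidHom.mk' (AlgebraicCycle.map π.left height height) (algebraicCycleMap_add π.left height height)
  let φ : AlgebraicCycle X'.left ℤ →+ AlgebraicCycle X.left ℤ :=
    mapHom.comp (D.pullbackRep π.left).interCycleHom - D.interCycleHom.comp mapHom
  have hφ : ∀ γ, φ γ = AlgebraicCycle.map π.left height height ((D.pullbackRep π.left).interCycle γ) -
      D.interCycle (AlgebraicCycle.map π.left height height γ) := fun γ => rfl
  have hsum : φ β = ∑ z ∈ hβ.toFinset, β z • φ (primeCycle z) := by
    conv_lhs => rw [eq_sum_smul_primeCycle_of_finite β hβ]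
    rw [map_sum]
    simp only [map_zsmul]
  rw [← hφ, hsum]
  refine AddSubgroup.sum_mem _ fun z' hz' => ?_
  have hz'0 : β z' ≠ 0 := hβ.mem_toFinset.mp hz'
  have hzd : height z' = d + 1 := by
    rw [hβd z' hz'0]
    push_cast
    rfl
  refine AddSubgroup.zsmul_mem _ ?_ _
  -- the prime cycle `[closure {z'}]`
  rw [hφ, interCycle_primeCycle, algebraicCycleMap_primeCycle_eq_nsmul, ← natCast_zsmul,
    interCycle_zsmul, interCycle_primeCycle]
  refine ratTrivialOn_mono (Set.inter_subset_inter_left _ fun x hx => ?_)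
    (map_primeInter_pullbackRep_sub_smul_mem π D hzd)
  exact ⟨z', hz'0, specializes_iff_mem_closure.mpr hx⟩

end CycleRep

end CartierDivisor

end Literature.AlgebraicGeometry.Motives

end
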